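import Summits.AtomisticToContinuum.Crystallization.Theorems.FreeSplittingCertificatesStrictSplittingRuleFarPencilIntegral
import Summits.AtomisticToContinuum.Crystallization.Theorems.FreeSplittingCertificatesStrictSplittingRuleFarSymbol

/-!
# `StrictSplittingRule` (stmt-AtomisticToContinuum-12560): the integrated far pencil against the HCP SHELL receipts form

Route `FreeSplittingCertificates`, crux r3 `StrictSplittingRule` (H12⋆ = `stub_coreJointCoercive`), unit b2b-freesplit-B gen 10.
VALUE = the continuum far lemma stated against the receipts form the lattice actually has — NOT a proof of H12⋆, NOT summit progress.

The receipts of the `r⁻⁶` import family at a site `x` are `ω(r_x)·Σ_{s ∈ shell} ⟪y_s, Δ_s u⟫²`, whose continuum density is `r⁻⁶·fpShell a h (∇v)`,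
`fpShell a h G = Σ_{s ∈ hcpStarIdx} ⟪y_s, G y_s⟫²` (the quartic shell form of `…FarSymbol`, `hcpShell_strain_form`), not the isotropic twelve-design form
`a⁴·(4/5)((tr G)² + 2|sym G|²) = a⁴·fpRec G` used by `…FarPencilPointwise/Integral`.  The landed sandwich `hcpShell_strain_form_ideal_ge` (ideal ratio
`h² = 2a²/3`: `shell ≥ (5/6)·a⁴·fpRec`) and the isotropic bound `hcpShell_strain_form_ge` (all `a, h`: `shell ≥ min((5/3)a⁴, 2a²h², 3h⁴)·|sym G|²`) give
* `fpRec_le_shell_ideal`: `a⁴·fpRec G ≤ (6/5)·fpShell a h G` at the ideal ratio; `fpRec_le_shell`: `μ·fpRec G ≤ 4·fpShell a h G`, `μ = min((5/3)a⁴, 2a²h², 3h⁴)`, all `a, h`;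
* **`farPencil_integral_le_hcpShell_ideal`**: `∫ Num ≤ (17/200)·(6/5)·a⁻⁴·∫ |x|⁻⁶·fpShell a h (∇v)` (ideal ratio) — HOME CERT §16 (3)'s `t*_cont,hcp ≤ (17/200)(6/5)/(c₆a⁴)`
  as a theorem about test fields (`v ∈ C²` compactly supported, `0 ∉ tsupport v`);
* **`farPencil_integral_le_hcpShell`**: `∫ Num ≤ (17/200)·(4/μ)·∫ |x|⁻⁶·fpShell a h (∇v)` for ALL `a, h ≠ 0` (crude but box-free constant).
HONEST FRAMING: continuum statement; the lattice→continuum transfer (site weights `ω`, stretch vs. gradient, site density) is not here; NOT a proof of H12⋆,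
NOT summit progress.
-/

noncomputable section

open MeasureTheory Topology Filter
open scoped BigOperators

namespace Summit.AtomisticToContinuum.Crystallization.Theorems.StrictSplittingRuleBirth

open Literature.MathematicalPhysics.StatisticalMechanics
open Summit.AtomisticToContinuum.Crystallization.Theorems.PalmUnimodularRigidity.LayeredLawsSelectHcp

variable {v : (Fin 3 → ℝ) → (Fin 3 → ℝ)}

/-- **The hcp shell receipts form** `Σ_{s ∈ hcpStarIdx} ⟪y_s, G y_s⟫²` (`y_s = hcpSite a h s`; only `sym G` enters). -/
def fpShell (a h : ℝ) (G : Fin 3 → Fin 3 → ℝ) : ℝ :=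
  ∑ s ∈ hcpStarIdx,
    (G 0 0 * hcpSite a h s 0 ^ 2 + G 1 1 * hcpSite a h s 1 ^ 2 + G 2 2 * hcpSite a h s 2 ^ 2 +
        2 * ((G 0 1 + G 1 0) / 2) * (hcpSite a h s 0 * hcpSite a h s 1) +
        2 * ((G 0 2 + G 2 0) / 2) * (hcpSite a h s 0 * hcpSite a h s 2) +
      2 * ((G 1 2 + G 2 1) / 2) * (hcpSite a h s 1 * hcpSite a h s 2)) ^ 2

/-- The shell form is nonnegative. -/
theorem fpShell_nonneg (a h : ℝ) (G : Fin 3 → Fin 3 → ℝ) : 0 ≤ fpShell a h G :=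
  Finset.sum_nonneg fun _ _ => sq_nonneg _

/-- The shell form vanishes at `G = 0`. -/
theorem fpShell_zero (a h : ℝ) : fpShell a h (fun _ _ => 0) = 0 := by
  simp [fpShell]

/-- **Ideal ratio**: the isotropic receipts are at most `6/5` of the shell receipts, `a⁴·fpRec G ≤ (6/5)·fpShell a h G` (`h² = 2a²/3`). -/
theorem fpRec_le_shell_ideal (a h : ℝ) (hid : h ^ 2 = 2 / 3 * a ^ 2) (G : Fin 3 → Fin 3 → ℝ) :
    a ^ 4 * fpRec G ≤ 6 / 5 * fpShell a h G := by
  have h1 := hcpShell_strain_form_ideal_ge a h (G 0 0) (G 1 1) (G 2 2) ((G 0 1 + G 1 0) / 2) ((G 0 2 + G 2 0) / 2)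
    ((G 1 2 + G 2 1) / 2) hid
  have hS : fpShell a h G = ∑ s ∈ hcpStarIdx,
      (G 0 0 * hcpSite a h s 0 ^ 2 + G 1 1 * hcpSite a h s 1 ^ 2 + G 2 2 * hcpSite a h s 2 ^ 2 +
          2 * ((G 0 1 + G 1 0) / 2) * (hcpSite a h s 0 * hcpSite a h s 1) +
          2 * ((G 0 2 + G 2 0) / 2) * (hcpSite a h s 0 * hcpSite a h s 2) +
        2 * ((G 1 2 + G 2 1) / 2) * (hcpSite a h s 1 * hcpSite a h s 2)) ^ 2 := rfl
  have hR : fpRec G = 4 / 5 * ((G 0 0 + G 1 1 + G 2 2) ^ 2 +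
      2 * (G 0 0 ^ 2 + G 1 1 ^ 2 + G 2 2 ^ 2 + 2 * ((G 0 1 + G 1 0) / 2) ^ 2 + 2 * ((G 0 2 + G 2 0) / 2) ^ 2 +
        2 * ((G 1 2 + G 2 1) / 2) ^ 2)) := by
    unfold fpRec fpTr fpSymSq; ring
  rw [hS, hR]
  linarith

/-- **All `a, h`**: `μ·fpRec G ≤ 4·fpShell a h G` with `μ = min((5/3)a⁴, 2a²h², 3h⁴)` (`(tr G)² ≤ 3Σ(sym G)ᵢᵢ²` and `hcpShell_strain_form_ge`). -/
theorem fpRec_le_shell (a h : ℝ) (G : Fin 3 → Fin 3 → ℝ) :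
    min (min (5 / 3 * a ^ 4) (2 * a ^ 2 * h ^ 2)) (3 * h ^ 4) * fpRec G ≤ 4 * fpShell a h G := by
  set μ := min (min (5 / 3 * a ^ 4) (2 * a ^ 2 * h ^ 2)) (3 * h ^ 4) with hμ
  have h1 := hcpShell_strain_form_ge a h (G 0 0) (G 1 1) (G 2 2) ((G 0 1 + G 1 0) / 2) ((G 0 2 + G 2 0) / 2)
    ((G 1 2 + G 2 1) / 2)
  rw [← hμ] at h1
  have hS : fpShell a h G = ∑ s ∈ hcpStarIdx,
      (G 0 0 * hcpSite a h s 0 ^ 2 + G 1 1 * hcpSite a h s 1 ^ 2 + G 2 2 * hcpSite a h s 2 ^ 2 +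
          2 * ((G 0 1 + G 1 0) / 2) * (hcpSite a h s 0 * hcpSite a h s 1) +
          2 * ((G 0 2 + G 2 0) / 2) * (hcpSite a h s 0 * hcpSite a h s 2) +
        2 * ((G 1 2 + G 2 1) / 2) * (hcpSite a h s 1 * hcpSite a h s 2)) ^ 2 := rfl
  have hμ0 : 0 ≤ μ := by positivity
  -- `fpRec G ≤ 4·|sym G|²`
  have hR : fpRec G ≤ 4 * (G 0 0 ^ 2 + G 1 1 ^ 2 + G 2 2 ^ 2 + 2 * ((G 0 1 + G 1 0) / 2) ^ 2 +
      2 * ((G 0 2 + G 2 0) / 2) ^ 2 + 2 * ((G 1 2 + G 2 1) / 2) ^ 2) := by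
    unfold fpRec fpTr fpSymSq
    nlinarith [sq_nonneg (G 0 0 - G 1 1), sq_nonneg (G 0 0 - G 2 2), sq_nonneg (G 1 1 - G 2 2),
      sq_nonneg ((G 0 1 + G 1 0) / 2), sq_nonneg ((G 0 2 + G 2 0) / 2), sq_nonneg ((G 1 2 + G 2 1) / 2)]
  rw [hS]
  nlinarith [mul_le_mul_of_nonneg_left hR hμ0, h1]

/-! ## Integrability of the shell receipts density along a compactly supported field -/

/-- The shell form is a continuous function of the matrix. -/
theorem continuous_fpShell (a h : ℝ) : Continuous (fpShell a h) := by
  unfold fpShell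
  refine continuous_finsetSum _ fun s _ => ?_
  fun_prop

/-- `|x|⁻⁶·fpShell(∇v)` along a `C²` compactly supported field with `0 ∉ tsupport v` is integrable. -/
theorem integrable_fpShell (hv : ContDiff ℝ 2 v) (hc : HasCompactSupport v) (h0 : (0 : Fin 3 → ℝ) ∉ tsupport v) (a h : ℝ) :
    Integrable fun y => (fpSq y)⁻¹ ^ 3 * fpShell a h (fpGrad v y) := by
  have hGc : Continuous (fpGrad v) := continuous_fpGrad hv
  refine fp_integrable hc (fun y hy => ?_) (fun y hy => ?_)
  · have hu := continuousAt_fpSq_inv (fp_zero_notMem_tsupport h0 hy)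
    exact (hu.pow 3).mul ((continuous_fpShell a h).comp hGc).continuousAt
  · have h2 : fderiv ℝ v y = 0 := image_eq_zero_of_notMem_tsupport fun h' => hy (tsupport_fderiv_subset ℝ h')
    have : fpGrad v y = fun _ _ => 0 := by funext i j; simp [fpGrad, h2]
    rw [this, fpShell_zero, mul_zero]

/-! ## The far pencil against the shell receipts -/

/-- **THE CONTINUUM FAR PENCIL AGAINST HCP SHELL RECEIPTS, ideal ratio** (`h² = 2a²/3`, `a ≠ 0`): for every `C²` compactly supported field with
`0 ∉ tsupport v`, `∫ Num ≤ (17/200)·(6/5)·a⁻⁴·∫ |x|⁻⁶·Σ_{s∈shell}⟪y_s, ∇v y_s⟫²`.  NOT a proof of H12⋆, NOT summit progress. -/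
theorem farPencil_integral_le_hcpShell_ideal (hv : ContDiff ℝ 2 v) (hc : HasCompactSupport v) (h0 : (0 : Fin 3 → ℝ) ∉ tsupport v)
    {a h : ℝ} (ha : a ≠ 0) (hid : h ^ 2 = 2 / 3 * a ^ 2) :
    ∫ x, fpNum x (v x) (fpGrad v x) ≤ 17 / 200 * (6 / 5 * (a ^ 4)⁻¹) * ∫ x, (fpSq x)⁻¹ ^ 3 * fpShell a h (fpGrad v x) := by
  have hmain := farPencil_integral_le hv hc h0
  have iD := integrable_fpDen hv hc h0
  have iS := integrable_fpShell hv hc h0 a h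
  have ha4 : 0 < a ^ 4 := by positivity
  have hpt : ∀ x, fpDen x (fpGrad v x) ≤ 6 / 5 * (a ^ 4)⁻¹ * ((fpSq x)⁻¹ ^ 3 * fpShell a h (fpGrad v x)) := by
    intro x
    have hu : 0 ≤ (fpSq x)⁻¹ ^ 3 := pow_nonneg (inv_nonneg.2 (fpSq_nonneg x)) 3
    have h1 := fpRec_le_shell_ideal a h hid (fpGrad v x)
    have h2 : fpRec (fpGrad v x) ≤ 6 / 5 * (a ^ 4)⁻¹ * fpShell a h (fpGrad v x) := by
      rw [show 6 / 5 * (a ^ 4)⁻¹ * fpShell a h (fpGrad v x) = (a ^ 4)⁻¹ * (6 / 5 * fpShell a h (fpGrad v x)) by ring]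
      rw [le_inv_mul_iff₀ ha4]
      exact h1
    unfold fpDen
    nlinarith [mul_le_mul_of_nonneg_left h2 hu]
  have h3 : ∫ x, fpDen x (fpGrad v x) ≤ ∫ x, 6 / 5 * (a ^ 4)⁻¹ * ((fpSq x)⁻¹ ^ 3 * fpShell a h (fpGrad v x)) :=
    integral_mono iD (iS.const_mul _) hpt
  rw [integral_const_mul] at h3
  nlinarith [hmain, h3]

/-- **THE CONTINUUM FAR PENCIL AGAINST HCP SHELL RECEIPTS, all `a, h ≠ 0`**: with `μ = min((5/3)a⁴, 2a²h², 3h⁴)`,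
`∫ Num ≤ (17/200)·(4/μ)·∫ |x|⁻⁶·Σ_{s∈shell}⟪y_s, ∇v y_s⟫²`.  NOT a proof of H12⋆, NOT summit progress. -/
theorem farPencil_integral_le_hcpShell (hv : ContDiff ℝ 2 v) (hc : HasCompactSupport v) (h0 : (0 : Fin 3 → ℝ) ∉ tsupport v)
    {a h : ℝ} (ha : a ≠ 0) (hh : h ≠ 0) :
    ∫ x, fpNum x (v x) (fpGrad v x) ≤
      17 / 200 * (4 * (min (min (5 / 3 * a ^ 4) (2 * a ^ 2 * h ^ 2)) (3 * h ^ 4))⁻¹) *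
        ∫ x, (fpSq x)⁻¹ ^ 3 * fpShell a h (fpGrad v x) := by
  set μ := min (min (5 / 3 * a ^ 4) (2 * a ^ 2 * h ^ 2)) (3 * h ^ 4) with hμ
  have hμ0 : 0 < μ := by
    have ha2 : 0 < a ^ 2 := by positivity
    have hh2 : 0 < h ^ 2 := by positivity
    simp only [hμ, lt_min_iff]
    refine ⟨⟨by positivity, by positivity⟩, by positivity⟩
  have hmain := farPencil_integral_le hv hc h0
  have iD := integrable_fpDen hv hc h0
  have iS := integrable_fpShell hv hc h0 a h
  have hpt : ∀ x, fpDen x (fpGrad v x) ≤ 4 * μ⁻¹ * ((fpSq x)⁻¹ ^ 3 * fpShell a h (fpGrad v x)) := by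
    intro x
    have hu : 0 ≤ (fpSq x)⁻¹ ^ 3 := pow_nonneg (inv_nonneg.2 (fpSq_nonneg x)) 3
    have h1 := fpRec_le_shell a h (fpGrad v x)
    rw [← hμ] at h1
    have h2 : fpRec (fpGrad v x) ≤ 4 * μ⁻¹ * fpShell a h (fpGrad v x) := by
      rw [show 4 * μ⁻¹ * fpShell a h (fpGrad v x) = μ⁻¹ * (4 * fpShell a h (fpGrad v x)) by ring]
      rw [le_inv_mul_iff₀ hμ0]
      exact h1
    unfold fpDen
    nlinarith [mul_le_mul_of_nonneg_left h2 hu]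
  have h3 : ∫ x, fpDen x (fpGrad v x) ≤ ∫ x, 4 * μ⁻¹ * ((fpSq x)⁻¹ ^ 3 * fpShell a h (fpGrad v x)) :=
    integral_mono iD (iS.const_mul _) hpt
  rw [integral_const_mul] at h3
  nlinarith [hmain, h3]

end Summit.AtomisticToContinuum.Crystallization.Theorems.StrictSplittingRuleBirth
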